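import Mathlib

/-!
# PneNP / OverlapGapAlgebra — `SearchHardWindow`: the algebraic rung, XORSAT contrast

Support (calibration / non-vacuity) for the algebraic rung of crux `stmt-PneNP-2460`
(`…SearchHardWindowAffineRungCore/Count/…Rung`): the class of SIGN-AFFINE search maps — for every
variable skeleton `S`, `signs ↦ g (S ⊗ signs)` preserves `x ⊕ y ⊕ z` output bit by output bit —
which solves random k-SAT with probability at most `(1 - 2^{-k})^{m-n}` (`shwAff_successCount_le`),
is exactly the class that solves k-XORSAT COMPLETELY: Gaussian elimination with a fixed
generalised inverse per skeleton is sign-affine and XOR-satisfies every XOR-satisfiable instance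
(`shwAff_xorsat_signAffine_solver`). Same instances `Φ : Fin m → Fin k → Fin n × Bool`, same
literal semantics (`(v, b)` true under `σ` iff `σ v = b`); a clause is XOR-satisfied iff an ODD
number of its literals is true. So on XORSAT the class achieves the maximum possible success
probability `Pr[Φ XOR-satisfiable]` (bounded away from `0` below the k-XORSAT threshold, e.g.
`≈ 0.918` at `k = 3`), deep inside the clustered phase where every stable algorithm fails — the
literature's certified exception to "overlap gap ⇒ hard" — while on SAT it fails at every `α > 1`.

* `shwAff_exists_genInverse` — every linear map between vector spaces has a linear generalised
  inverse (`L (G y) = y` on the range);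
* `shwAff_odd_iff_sum` — parity of the true literals of a clause as a GF(2)-linear equation in the
  assignment, with right-hand side affine in the polarities;
* `shwAff_xorsat_signAffine_solver` — the contrast theorem.
No definitions; axioms `propext`, `Classical.choice`, `Quot.sound`.
-/

set_option linter.dupNamespace false -- `Summit.PneNP.PneNP.…`: summit = sub-problem (D-0017)

namespace Summit.PneNP.PneNP.Theorems

open Finset
open scoped Classical

section XorContrast

/-- Every linear map between vector spaces has a linear generalised inverse. -/
theorem shwAff_exists_genInverse {K V W : Type*} [Field K] [AddCommGroup V] [Module K V]
    [AddCommGroup W] [Module K W] (L : V →ₗ[K] W) :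
    ∃ G : W →ₗ[K] V, ∀ y ∈ LinearMap.range L, L (G y) = y := by
  obtain ⟨g₀, hg₀⟩ := L.rangeRestrict.exists_rightInverse_of_surjective L.range_rangeRestrict
  obtain ⟨q, hq⟩ := (LinearMap.range L).exists_isCompl
  refine ⟨g₀ ∘ₗ (LinearMap.range L).projectionOnto q hq, fun y hy => ?_⟩
  have h1 : (LinearMap.range L).projectionOnto q hq y = ⟨y, hy⟩ :=
    Submodule.projectionOnto_apply_of_mem_left hq hy
  have h2 := LinearMap.congr_fun hg₀ ⟨y, hy⟩
  have h3 : L (g₀ ⟨y, hy⟩) = y := congrArg Subtype.val h2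
  simp only [LinearMap.coe_comp, Function.comp_apply, h1]
  exact h3

variable {m k n : ℕ}

/-- Parity of the true literals of clause `i` under `σ` as a GF(2)-linear equation:
`Odd #{j : σ (S i j) = b i j} ↔ ∑ j, σ' (S i j) = 1 + ∑ j, (b' i j + 1)` (`'` = `Bool → ZMod 2`). -/
theorem shwAff_odd_iff_sum (S : Fin m → Fin k → Fin n) (b : Fin m → Fin k → Bool)
    (σ : Fin n → Bool) (i : Fin m) :
    Odd ((univ : Finset (Fin k)).filter fun j => σ (S i j) = b i j).card ↔
      (∑ j, (if σ (S i j) then (1 : ZMod 2) else 0)) =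
        1 + ∑ j, ((if b i j then (1 : ZMod 2) else 0) + 1) := by
  rw [← ZMod.natCast_eq_one_iff_odd]
  have hcard : ((((univ : Finset (Fin k)).filter fun j => σ (S i j) = b i j).card : ℕ) : ZMod 2) =
      ∑ j, (if σ (S i j) = b i j then (1 : ZMod 2) else 0) := by
    rw [Finset.sum_boole]
  have hpt : ∀ j, (if σ (S i j) = b i j then (1 : ZMod 2) else 0) =
      (if σ (S i j) then (1 : ZMod 2) else 0) + ((if b i j then (1 : ZMod 2) else 0) + 1) := by
    intro j
    cases σ (S i j) <;> cases b i j <;> decide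
  rw [hcard, sum_congr rfl fun j _ => hpt j, sum_add_distrib]
  generalize (∑ j, (if σ (S i j) then (1 : ZMod 2) else 0)) = A
  generalize (∑ j, ((if b i j then (1 : ZMod 2) else 0) + 1)) = B
  revert A B
  decide

/-- **XORSAT contrast.** There is a SIGN-AFFINE search map (ternary-xor preserving in the
polarities for every fixed variable skeleton, output bit by output bit — the class of
`shwAff_successCount_le`) that XOR-satisfies every XOR-satisfiable instance: Gaussian elimination
with a fixed generalised inverse per skeleton. -/
theorem shwAff_xorsat_signAffine_solver :
    ∃ g : (Fin m → Fin k → Fin n × Bool) → (Fin n → Bool),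
      (∀ (S : Fin m → Fin k → Fin n) (x y z : Fin m → Fin k → Bool) (v : Fin n),
        g (fun i j => (S i j, (x i j ^^ y i j) ^^ z i j)) v =
          ((g (fun i j => (S i j, x i j)) v ^^ g (fun i j => (S i j, y i j)) v) ^^
            g (fun i j => (S i j, z i j)) v)) ∧
      ∀ Φ : Fin m → Fin k → Fin n × Bool,
        (∃ σ : Fin n → Bool, ∀ i, Odd ((univ : Finset (Fin k)).filter
          fun j => σ (Φ i j).1 = (Φ i j).2).card) →
        ∀ i, Odd ((univ : Finset (Fin k)).filter fun j => g Φ (Φ i j).1 = (Φ i j).2).card := by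
  -- the linear map of a skeleton and its generalised inverse
  let L : (Fin m → Fin k → Fin n) → (Fin n → ZMod 2) →ₗ[ZMod 2] (Fin m → ZMod 2) := fun S =>
    { toFun := fun x i => ∑ j, x (S i j)
      map_add' := by
        intro x x'
        funext i
        simp [sum_add_distrib]
      map_smul' := by
        intro c x
        funext i
        simp [mul_sum] }
  have hG : ∀ S, ∃ G : (Fin m → ZMod 2) →ₗ[ZMod 2] (Fin n → ZMod 2),
      ∀ y ∈ LinearMap.range (L S), L S (G y) = y := fun S => shwAff_exists_genInverse (L S)
  choose G hG using hG
  -- right-hand sides (affine in the polarities) and the solver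
  let R : (Fin m → Fin k → Bool) → (Fin m → ZMod 2) := fun b i =>
    1 + ∑ j, ((if b i j then (1 : ZMod 2) else 0) + 1)
  refine ⟨fun Φ v => decide (G (fun i j => (Φ i j).1) (R fun i j => (Φ i j).2) v = 1), ?_, ?_⟩
  · -- sign-affinity
    intro S x y z v
    have hR : R (fun i j => (x i j ^^ y i j) ^^ z i j) = R x + R y + R z := by
      funext i
      simp only [R, Pi.add_apply]
      have hpt : ∀ j, ((if ((x i j ^^ y i j) ^^ z i j) then (1 : ZMod 2) else 0) + 1) =
          ((if x i j then (1 : ZMod 2) else 0) + 1) + ((if y i j then (1 : ZMod 2) else 0) + 1) +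
            ((if z i j then (1 : ZMod 2) else 0) + 1) := by
        intro j
        cases x i j <;> cases y i j <;> cases z i j <;> decide
      rw [sum_congr rfl fun j _ => hpt j, sum_add_distrib, sum_add_distrib]
      generalize (∑ j, ((if x i j then (1 : ZMod 2) else 0) + 1)) = A
      generalize (∑ j, ((if y i j then (1 : ZMod 2) else 0) + 1)) = B
      generalize (∑ j, ((if z i j then (1 : ZMod 2) else 0) + 1)) = C
      have h3 : (1 : ZMod 2) = 1 + 1 + 1 := by decide
      conv_lhs => rw [h3]
      abel
    show decide (G S (R fun i j => (x i j ^^ y i j) ^^ z i j) v = 1) =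
      ((decide (G S (R x) v = 1) ^^ decide (G S (R y) v = 1)) ^^ decide (G S (R z) v = 1))
    rw [hR, map_add, map_add, Pi.add_apply, Pi.add_apply]
    generalize G S (R x) v = a
    generalize G S (R y) v = a'
    generalize G S (R z) v = a''
    revert a a' a''
    decide
  · -- it XOR-satisfies every XOR-satisfiable instance
    intro Φ hΦ i
    obtain ⟨σ, hσ⟩ := hΦ
    set S : Fin m → Fin k → Fin n := fun i j => (Φ i j).1 with hS
    set b : Fin m → Fin k → Bool := fun i j => (Φ i j).2 with hb
    -- `σ` solves the linear system, so its right-hand side is in the range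
    have hrange : R b ∈ LinearMap.range (L S) := by
      refine ⟨fun v => if σ v then 1 else 0, ?_⟩
      funext i'
      have := (shwAff_odd_iff_sum S b σ i').1 (hσ i')
      simpa [L, R] using this
    have hsol : L S (G S (R b)) = R b := hG S (R b) hrange
    have hi : (∑ j, G S (R b) (S i j)) = R b i := by
      have := congrFun hsol i
      simpa [L] using this
    -- read the solution back as a Boolean assignment
    have hback : ∀ w : ZMod 2, (if decide (w = 1) then (1 : ZMod 2) else 0) = w := by decide
    have key := (shwAff_odd_iff_sum S b (fun v => decide (G S (R b) v = 1)) i).2 (by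
      simp only [hback]
      simpa [R] using hi)
    simpa [hS, hb] using key

end XorContrast

end Summit.PneNP.PneNP.Theorems
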